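import Summits.Schanuel.Schanuel.Theorems.ZilberEacNonRealPlacePoints
import Summits.Schanuel.Schanuel.Theorems.ZilberEacDegenerateAllSurfaces
import HarnessLib

/-!
# The exponential-polynomial regime, CXXVII: THE COMPLETE VERDICT OVER CURVES WITH AN EQUAL-ORDER
# PLACE OF NON-REAL DIRECTION — EVERY SURFACE OF MANTOVA–MASSER'S CASE IS DENSE (O93)

HONEST FRAMING.  Cell `pub-schanuel` (Zilber's Exponential-Algebraic Closedness, case ladder;
host summit Schanuel), seat 2, gen 35.  Mantova–Masser (PLMS 2024 §1 p. 5) ask whether the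
unprojected exponential points of a surface `W` of their case (dim-π-S-1-free) are Zariski dense
in `W`.  THE ANSWER IS YES FOR EVERY `W` WHOSE BASE CURVE `C = {F = 0}` HAS AN EQUAL-ORDER PLACE
`x₀ = s^{-k}`, `x₁ = Φ(s)s^{-k}` OF NON-REAL DIRECTION `Im Φ(0) ≠ 0` — i.e. (for curves meeting
the line at infinity at a non-real point `[1 : ζ : 0]`) every Fermat curve `x₀ⁿ + x₁ⁿ = 1`
(`n ≥ 2`), the circle `x₀² + x₁² = 1`, …:
* **`unprojectedDense_of_mmCase_nonRealPlace`** — `F` with ANY coefficients, under `hfree`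
  (`x₀, x₁, y₁` satisfy no relation on `W` beyond `F`);
* **`unprojectedDense_of_mmCase_nonRealPlace_algebraic`** — `F ∈ ℚ̄[x₀][x₁]`, NO further
  hypothesis on `W` (when `hfree` fails `W` is a `y₀`-cylinder, dense by file XCVIII).
Proof: the minimal fibre polynomial `P` of `W` over `ℂ[x₀, x₁, y₁]` modulo `F` (file CII) has
`F ∤ lc(P)`, `F ∤ P(0)`; file CXXVI (lower Newton edge transported to the bottom edge by
`GL₂(ℤ)`, sign chosen by `Im Φ(0)`, sector engine, pull-back, guard) gives the density with
`S = W`, membership coming from the division `lc(P)^m G = QP + FH`.  NO arithmetic input (no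
Lindemann), no genericity.  What remains OPEN: base curves all of whose places at infinity have
REAL direction (rational: parabolic branches beyond files CIV/CVI; irrational real slopes),
transcendental coefficients for the cylinder case, Fib(3,2), EC(3,2); the question in general;
NOT Schanuel's conjecture (neither used nor implied); EAC ⇏ SC.
-/

noncomputable section

open Filter Topology Set Complex Polynomial
open Literature.NumberTheory.Transcendental Literature.ModelTheory.Zilber
open Literature.ModelTheory.ExponentialFields

set_option linter.dupNamespace false

namespace Summit.Schanuel.Schanuel.Theorems

section NonRealPlaceAllSurfaces

variable (F : ℂ[X][X])

/-- **THE COMPLETE VERDICT OVER A CURVE WITH AN EQUAL-ORDER PLACE OF NON-REAL DIRECTION (free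
form).**  `F` irreducible; a place `x₀ = s^{-k}`, `x₁ = Φ(s)s^{-k}` (`k ≥ 1`, `Φ` analytic,
`Im Φ(0) ≠ 0`); `F₃` = `F` inside `ℂ[x₀, x₁, y₁]`; `W` in Mantova–Masser's case with base curve
`{F = 0}` such that every `H ∈ ℂ[x₀, x₁, y₁]` vanishing on `W` is divisible by `F₃`.  Then the
unprojected exponential points are Zariski dense in `W`. [cite: MantovaMasser2023, §1 Further
remarks, p. 5 (the question, open in general)] (new) -/
theorem unprojectedDense_of_mmCase_nonRealPlace (hFirr : Irreducible F) {k : ℕ} (hk : 1 ≤ k)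
    {Φ : ℂ → ℂ} (hΦan : AnalyticAt ℂ Φ 0)
    (hplace : ∀ᶠ s in 𝓝[≠] (0 : ℂ),
      (F.map (Polynomial.evalRingHom (s ^ k)⁻¹)).eval (Φ s * (s ^ k)⁻¹) = 0)
    (hΦ : (Φ 0).im ≠ 0) (F₃ : MvPolynomial (Fin 3) ℂ)
    (hF₃ : ∀ v : Fin 3 → ℂ, MvPolynomial.eval v F₃ = (F.map (Polynomial.evalRingHom (v 0))).eval (v 1))
    {W : Set (Fin 2 ⊕ Fin 2 → ℂ)} (hmm : MMCaseDimPiOneFree W)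
    (hbase : MvPolynomial.zeroLocus ℂ (MvPolynomial.vanishingIdeal ℂ (projAdd '' (W ∩ torusLocus ℂ 2))) =
      {x : Fin 2 → ℂ | (F.map (Polynomial.evalRingHom (x 0))).eval (x 1) = 0})
    (hfree : ∀ H : MvPolynomial (Fin 3) ℂ,
      (∀ w ∈ W, MvPolynomial.eval ![w (Sum.inl 0), w (Sum.inl 1), w (Sum.inr 1)] H = 0) → F₃ ∣ H) :
    UnprojectedDense W := by
  classical
  -- the embedding `ι : B[y₀] → ℂ[x₀, x₁, y₀, y₁]`, `B = ℂ[x₀, x₁, y₁]` (as in file CIII)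
  set ι : Polynomial (MvPolynomial (Fin 3) ℂ) →+* MvPolynomial (Fin 2 ⊕ Fin 2) ℂ :=
    Polynomial.eval₂RingHom (MvPolynomial.eval₂Hom (S₁ := MvPolynomial (Fin 2 ⊕ Fin 2) ℂ)
      MvPolynomial.C (![MvPolynomial.X (Sum.inl 0), MvPolynomial.X (Sum.inl 1),
        MvPolynomial.X (Sum.inr 1)] : Fin 3 → MvPolynomial (Fin 2 ⊕ Fin 2) ℂ))
      (MvPolynomial.X (Sum.inr 0)) with hι
  have hC : ∀ a : ℂ, ι (Polynomial.C (MvPolynomial.C a)) = MvPolynomial.C a := by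
    intro a
    simp only [hι, Polynomial.coe_eval₂RingHom, Polynomial.eval₂_C, MvPolynomial.coe_eval₂Hom,
      MvPolynomial.eval₂_C]
  have h0 : ι (Polynomial.C (MvPolynomial.X 0)) = MvPolynomial.X (Sum.inl 0) := by
    simp only [hι, Polynomial.coe_eval₂RingHom, Polynomial.eval₂_C, MvPolynomial.coe_eval₂Hom,
      MvPolynomial.eval₂_X, Matrix.cons_val_zero]
  have h1 : ι (Polynomial.C (MvPolynomial.X 1)) = MvPolynomial.X (Sum.inl 1) := by
    simp only [hι, Polynomial.coe_eval₂RingHom, Polynomial.eval₂_C, MvPolynomial.coe_eval₂Hom,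
      MvPolynomial.eval₂_X, Matrix.cons_val_one, Matrix.cons_val_zero]
  have h2 : ι (Polynomial.C (MvPolynomial.X 2)) = MvPolynomial.X (Sum.inr 1) := by
    simp only [hι, Polynomial.coe_eval₂RingHom, Polynomial.eval₂_C, MvPolynomial.coe_eval₂Hom,
      MvPolynomial.eval₂_X]; rfl
  have hX : ι Polynomial.X = MvPolynomial.X (Sum.inr 0) := by
    simp only [hι, Polynomial.coe_eval₂RingHom, Polynomial.eval₂_X]
  have hev := eval_embed₄ ι hC h0 h1 h2 hX
  -- the prime `𝔭 = I(W)`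
  set 𝔭 : Ideal (MvPolynomial (Fin 2 ⊕ Fin 2) ℂ) := MvPolynomial.vanishingIdeal ℂ W with h𝔭
  haveI h𝔭p : 𝔭.IsPrime := hmm.1.2
  have hmem : ∀ G : Polynomial (MvPolynomial (Fin 3) ℂ), ι G ∈ 𝔭 ↔ ∀ w ∈ W,
      (G.map (MvPolynomial.eval ![w (Sum.inl 0), w (Sum.inl 1), w (Sum.inr 1)])).eval
        (w (Sum.inr 0)) = 0 := by
    intro G
    rw [h𝔭, MvPolynomial.mem_vanishingIdeal_iff]
    refine forall₂_congr fun w _ => ?_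
    rw [MvPolynomial.aeval_eq_eval, hev]
  obtain ⟨w₀, hw₀W, hw₀T⟩ := hmm.2.1
  have hy : ∀ i : Fin 2, (MvPolynomial.X (Sum.inr i) : MvPolynomial (Fin 2 ⊕ Fin 2) ℂ) ∉ 𝔭 := by
    intro i hi
    rw [h𝔭, MvPolynomial.mem_vanishingIdeal_iff] at hi
    have h := hi w₀ hw₀W
    rw [MvPolynomial.aeval_eq_eval, MvPolynomial.eval_X] at h
    exact (mem_torusLocus_iff.1 hw₀T) i h
  have hXmem : ι Polynomial.X ∉ 𝔭 := by rw [hX]; exact hy 0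
  -- `F ∈ 𝔭`
  have hFW : ∀ w ∈ W, w ∈ torusLocus ℂ 2 →
      (F.map (Polynomial.evalRingHom (w (Sum.inl 0)))).eval (w (Sum.inl 1)) = 0 := by
    intro w hwW hwT
    have hcl : projAdd w ∈ MvPolynomial.zeroLocus ℂ
        (MvPolynomial.vanishingIdeal ℂ (projAdd '' (W ∩ torusLocus ℂ 2))) :=
      MvPolynomial.zeroLocus_vanishingIdeal_le _ ⟨w, ⟨hwW, hwT⟩, rfl⟩
    rw [hbase] at hcl
    exact hcl
  have hFmem : ι (Polynomial.C F₃) ∈ 𝔭 := by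
    have hprod : ι (Polynomial.C F₃) * MvPolynomial.X (Sum.inr 0) * MvPolynomial.X (Sum.inr 1) ∈ 𝔭 := by
      rw [h𝔭, MvPolynomial.mem_vanishingIdeal_iff]
      intro w hwW
      rw [MvPolynomial.aeval_eq_eval, map_mul, map_mul, hev, MvPolynomial.eval_X, MvPolynomial.eval_X,
        Polynomial.map_C, Polynomial.eval_C, hF₃]
      simp only [Matrix.cons_val_zero, Matrix.cons_val_one]
      by_cases hwT : w ∈ torusLocus ℂ 2
      · rw [hFW w hwW hwT, zero_mul, zero_mul]
      · rw [mem_torusLocus_iff] at hwT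
        push Not at hwT
        obtain ⟨i, hi⟩ := hwT
        fin_cases i
        · simp only [Fin.zero_eta] at hi; rw [hi, mul_zero, zero_mul]
        · simp only [Fin.mk_one] at hi; rw [hi, mul_zero]
    rcases h𝔭p.mem_or_mem hprod with h | h
    · exact (h𝔭p.mem_or_mem h).elim id fun h' => (hy 0 h').elim
    · exact (hy 1 h).elim
  have hconst : ∀ H : MvPolynomial (Fin 3) ℂ, ι (Polynomial.C H) ∈ 𝔭 → F₃ ∣ H := by
    intro H hH
    refine hfree H fun w hw => ?_
    have h := (hmem _).1 hH w hw
    rwa [Polynomial.map_C, Polynomial.eval_C] at h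
  -- `F₃` is prime
  obtain ⟨Φr, hΦr⟩ := exists_rowsEquiv
  have hF₃eq : F₃ = MvPolynomial.rename (Fin.castSucc : Fin 2 → Fin 3) (Φr.symm F) := by
    refine MvPolynomial.funext fun v => ?_
    rw [hF₃, MvPolynomial.eval_rename]
    have e : (v ∘ (Fin.castSucc : Fin 2 → Fin 3)) = ![v 0, v 1] := by
      funext i; fin_cases i <;> rfl
    rw [e, hΦr, RingEquiv.apply_symm_apply]
  have hirrA : Irreducible (Φr.symm F) := by
    refine (irreducible_rows_iff (Q := F) fun x y => ?_).2 hFirr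
    rw [hΦr, RingEquiv.apply_symm_apply]
  have hprimeF₃ : Prime F₃ := by
    rw [hF₃eq]
    exact UniqueFactorizationMonoid.irreducible_iff_prime.1 (irreducible_rename_castSucc₂ hirrA)
  -- a relation with a coefficient `∉ (F₃)` exists: otherwise `𝔭 = (F̃)` and `dim W = 3`
  have hP₀ : ∃ P₀ : Polynomial (MvPolynomial (Fin 3) ℂ), ι P₀ ∈ 𝔭 ∧ ∃ j, ¬ F₃ ∣ P₀.coeff j := by
    by_contra hnone
    push Not at hnone
    have h𝔭eq : 𝔭 = Ideal.span {ι (Polynomial.C F₃)} := by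
      refine le_antisymm ?_ ((Ideal.span_singleton_le_iff_mem _).2 hFmem)
      intro G hG
      obtain ⟨Gy, hGy⟩ := exists_embed₄_poly ι hC h0 h1 h2 hX G
      have hall : ∀ j, F₃ ∣ Gy.coeff j := hnone Gy (by rw [hGy]; exact hG)
      obtain ⟨H, hH⟩ := (Polynomial.C_dvd_iff_dvd_coeff F₃ Gy).2 hall
      rw [Ideal.mem_span_singleton, ← hGy, hH, map_mul]
      exact Dvd.intro _ rfl
    have hFt0 : ι (Polynomial.C F₃) ≠ 0 := by
      intro h0
      apply hFirr.ne_zero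
      have hzero : ∀ x₀ x₁ : ℂ, (F.map (Polynomial.evalRingHom x₀)).eval x₁ = 0 := by
        intro x₀ x₁
        have h := hev (Sum.elim ![x₀, x₁] ![0, 0]) (Polynomial.C F₃)
        rw [h0, map_zero, Polynomial.map_C, Polynomial.eval_C, hF₃] at h
        simpa using h.symm
      refine Polynomial.ext fun j => Polynomial.funext fun x₀ => ?_
      have hG : F.map (Polynomial.evalRingHom x₀) = 0 :=
        Polynomial.funext fun x₁ => by rw [hzero, Polynomial.eval_zero]
      have hj := congrArg (fun G : ℂ[X] => G.coeff j) hG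
      simp only [Polynomial.coeff_map, Polynomial.coe_evalRingHom, Polynomial.coeff_zero] at hj
      rw [Polynomial.coeff_zero, Polynomial.eval_zero]
      exact hj
    have hprime : Prime (ι (Polynomial.C F₃)) := (Ideal.span_singleton_prime hFt0).1 (h𝔭eq ▸ h𝔭p)
    have h𝔭eq' : MvPolynomial.vanishingIdeal ℂ W = Ideal.span {ι (Polynomial.C F₃)} := by
      rw [← h𝔭]; exact h𝔭eq
    set f : MvPolynomial (Fin 2 ⊕ Fin 2) ℂ ≃+* MvPolynomial (Fin 4) ℂ :=
      (MvPolynomial.renameEquiv ℂ finSumFinEquiv).toRingEquiv with hf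
    have hprime' : Prime (f (ι (Polynomial.C F₃))) := (MulEquiv.prime_iff f).2 hprime
    have hmap : Ideal.span {f (ι (Polynomial.C F₃))} =
        (Ideal.span {ι (Polynomial.C F₃)}).map
          (f : MvPolynomial (Fin 2 ⊕ Fin 2) ℂ →+* MvPolynomial (Fin 4) ℂ) := by
      rw [Ideal.map_span, Set.image_singleton]; rfl
    have hdim3 : zariskiDim ℂ W = ((4 - 1 : ℕ) : WithBot ℕ∞) := by
      rw [← Literature.RingTheory.KrullDimension.ringKrullDim_quotient_span_of_prime_mvPolynomial hprime']
      show ringKrullDim (MvPolynomial (Fin 2 ⊕ Fin 2) ℂ ⧸ MvPolynomial.vanishingIdeal ℂ W) = _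
      exact (ringKrullDim_eq_of_ringEquiv (Ideal.quotEquivOfEq h𝔭eq')).trans
        (ringKrullDim_eq_of_ringEquiv (Ideal.quotientEquiv _ _ f hmap))
    have h23 : ((2 : ℕ) : WithBot ℕ∞) = ((4 - 1 : ℕ) : WithBot ℕ∞) := by rw [← hdim3]; exact hmm.2.2.1.symm
    have := Nat.cast_injective (R := WithBot ℕ∞) h23
    omega
  obtain ⟨P₀, hP₀mem, hP₀nd⟩ := hP₀
  -- the minimal polynomial over `B = ℂ[x₀, x₁, y₁]`
  obtain ⟨P, hP, hd, htop, hbot, -, hdiv⟩ :=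
    exists_minimalPolynomial_domain (ι := ι) (𝔭 := 𝔭) hprimeF₃ hFmem hconst hXmem hP₀mem hP₀nd
  -- file CXXVI with `S = W`
  have hWcl : W = MvPolynomial.zeroLocus ℂ 𝔭 := eq_zeroLocus_vanishingIdeal_of_isZariskiClosed hmm.1.1
  refine unprojectedDense_nonRealPlace_relation F hFirr hk hΦan hplace hΦ F₃ hF₃ P hd htop hbot hmm.1
    (le_of_eq hmm.2.2.1) ?_
  intro x₀ x₁ y₀ y₁ hFx hy₀ hy₁ hlc hPy
  rw [hWcl, MvPolynomial.mem_zeroLocus_iff]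
  intro G hG
  obtain ⟨Gy, hGy⟩ := exists_embed₄_poly ι hC h0 h1 h2 hX G
  obtain ⟨m, Q, H, hQH, hH⟩ := hdiv Gy (by rw [hGy]; exact hG)
  obtain ⟨H₁, rfl⟩ := (Polynomial.C_dvd_iff_dvd_coeff F₃ H).2 hH
  rw [MvPolynomial.aeval_eq_eval, ← hGy, hev]
  simp only [Sum.elim_inl, Sum.elim_inr, Matrix.cons_val_zero, Matrix.cons_val_one]
  have h := congrArg (fun T : Polynomial (MvPolynomial (Fin 3) ℂ) =>
    (T.map (MvPolynomial.eval ![x₀, x₁, y₁])).eval y₀) hQH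
  simp only [Polynomial.map_mul, Polynomial.map_pow, Polynomial.map_C, Polynomial.map_add,
    Polynomial.eval_mul, Polynomial.eval_pow, Polynomial.eval_C, Polynomial.eval_add] at h
  rw [hPy, hF₃] at h
  simp only [Matrix.cons_val_zero, Matrix.cons_val_one] at h
  rw [hFx, mul_zero, zero_mul, add_zero] at h
  exact (mul_eq_zero.1 h).resolve_left (pow_ne_zero _ hlc)

/-- **THE COMPLETE VERDICT OVER `ℚ̄`-CURVES WITH AN EQUAL-ORDER PLACE OF NON-REAL DIRECTION.**
`F ∈ ℚ̄[x₀][x₁]` irreducible; a place `x₀ = s^{-k}`, `x₁ = Φ(s)s^{-k}` with `Im Φ(0) ≠ 0`: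
EVERY surface of Mantova–Masser's case with base curve `{F = 0}` has Zariski-dense unprojected
exponential points. [cite: MantovaMasser2023, §1 Further remarks, p. 5 (the question, open in
general)] (new) -/
theorem unprojectedDense_of_mmCase_nonRealPlace_algebraic (hFirr : Irreducible F)
    (halg : ∀ i j, IsAlgebraic ℚ ((F.coeff j).coeff i)) {k : ℕ} (hk : 1 ≤ k)
    {Φ : ℂ → ℂ} (hΦan : AnalyticAt ℂ Φ 0)
    (hplace : ∀ᶠ s in 𝓝[≠] (0 : ℂ),
      (F.map (Polynomial.evalRingHom (s ^ k)⁻¹)).eval (Φ s * (s ^ k)⁻¹) = 0)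
    (hΦ : (Φ 0).im ≠ 0) {W : Set (Fin 2 ⊕ Fin 2 → ℂ)} (hmm : MMCaseDimPiOneFree W)
    (hbase : MvPolynomial.zeroLocus ℂ (MvPolynomial.vanishingIdeal ℂ (projAdd '' (W ∩ torusLocus ℂ 2))) =
      {x : Fin 2 → ℂ | (F.map (Polynomial.evalRingHom (x 0))).eval (x 1) = 0}) :
    UnprojectedDense W := by
  classical
  obtain ⟨F₃, hF₃⟩ := exists_curve₃ F
  by_cases hfree : ∀ H : MvPolynomial (Fin 3) ℂ,
      (∀ w ∈ W, MvPolynomial.eval ![w (Sum.inl 0), w (Sum.inl 1), w (Sum.inr 1)] H = 0) → F₃ ∣ H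
  · exact unprojectedDense_of_mmCase_nonRealPlace F hFirr hk hΦan hplace hΦ F₃ hF₃ hmm hbase hfree
  · push Not at hfree
    obtain ⟨H, hHW, hH⟩ := hfree
    obtain ⟨Ft, hFt, hcoeff⟩ := exists_transposeRows F
    exact unprojectedDense_of_mmCase_cylinder₀ F Ft hFt (irreducible_of_transposeRows hFirr hFt)
      (fun i j => by rw [hcoeff]; exact halg j i) hmm hbase
      (cylinder₀_of_relation F hFirr F₃ hF₃ hmm hbase H hH hHW)

end NonRealPlaceAllSurfaces

end Summit.Schanuel.Schanuel.Theorems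

end
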